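import Summits.QuantumFields.BalabanUV.Beta.GAN24.WilsonGaugeLegContact
import Summits.QuantumFields.BalabanUV.Beta.WilsonDivergenceContact
import Summits.QuantumFields.BalabanUV.Beta.AxialDressingRooted

/-!
# `GAN24.ContactOneGaugeCellAlgebra` — CT-ROUTE step CT-3a, part 1 (ALGEBRA): the ONE-GAUGE CONTACT CELL of the cubic Wilson table is a
# MAXWELL PAIRING — `Σ_y ψ y · (gauge-leg difference) = ½(ψ_tip − ψ_mid)·(d*d δ_{(κ′,u)})_β(z)` for EVERY gauge function `ψ` (no support
# hypothesis), its `dψ`-form, the second-slot and the index-slot twins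

HONEST FRAMING (cell charter, verbatim): «discharging `BetaPertH` makes Bałaban's UV stability UNCONDITIONAL — a real constructive-QFT result;
it is NOT the continuum limit and NOT the Clay problem.»  DERIVED cell leaf (pub-balaban, G-an2-4 formalisation swarm → CRUX TEAM (2), seat
`b2b-balaban-gan24-formalise-leaf-02`, gen 46; module CT-3a of the row owner's `CT3-MECHANISM.md` v1 §3, offered to this seat): finite algebra and
finitely supported lattice sums over OUR objects; NO estimate, NO limit, nothing cited — every statement is kernel-proved ([folklore] = standard
finite algebra); no `[cite:]` tag, no `def`, no `def … : Prop`; it instantiates NO binder of the β-function wall and discharges NO letter of (CONV-C).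
NEVER «G-an2-4 closed»; NOT hS0, NOT D1, NOT `BetaPertH`, NOT continuum, NOT Clay.  «not in print; our bookkeeping».
HONEST DEPENDENCY (cell records, verbatim): «continuum YM on T⁴ ⇐ BetaPertH ∧ nine spine estimates (0/9 proved); BetaPertH ⇐ (D1) ∧ (D4) ∧ CAP+tail;
G-an2-4 gates asym, D1 and NE2/3/4.»
ABSOLUTE RULE (cell charter, verbatim): «No internally-minted statement may enter as a cited fact. Every hypothesis is either kernel-proved in this
package or a verbatim quotation of a PUBLISHED theorem with page reference. The manuscript(s) under audit are NOT citable for their own disputed steps —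
they are the thing under adjudication; programme-internal (2001/route/tribunal) claims are never citable.»

WHAT IS PROVED (generic `d`, on `ℤ^(d+1)`; `W := StepJetData.wilsonA d κ′ u`, field–field block; `e_α := unitVec α`; `d*d := curvAdj ∘ curv`).
* §1 THE GAUGE-SITE SUM IS FINITELY SUPPORTED — gen 45's by-parts law `WilsonGaugeLegContact.gaugeLeg_wilsonA_pair` re-cut WITHOUT the finite-support
  hypothesis on the gauge function (the accumulated gauge `Ψ` of the dressed legs is NOT finitely supported; the contact sites are):
  `gaugeLeg_wilsonA_sum_of_mem` (any finite `S ∋ u+e_{κ′}, z, z+e_β`), **`gaugeLeg_wilsonA_tsum`**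
  (`Σ'_y ψ y·Σ_α (W (y−e_α) z α β − W y z α β) = ½(ψ(u+e_{κ′}) − ½(ψ z + ψ(z+e_β)))·(d*d δ_{(κ′,u)})_β z` for EVERY `ψ : ℤ^(d+1) → ℝ`),
  `summable_gaugeLeg_wilsonA`, the twins for the SECOND table slot (`…_right`, sign `−`, by `wilsonA_antisymm`), and the INDEX slot
  **`gaugeIdx_wilsonA_tsum`** (`Σ'_y ψ y·Σ_μ (W μ (y−e_μ) x z a b − W μ y x z a b) = ½(ψ z − ψ x)·(d*d δ_{(b,z)})_a(x)`, SITE weights — D1-leaf-05's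
  `WilsonDivergenceContact.divV_wilsonA_inl_inl` ∕ `divV_wilsonA_eq_zero` BY NAME).
* §2 THE `dψ`-FORM (what a dressed leg `T + dz Ψ` literally inserts): `wilsonA_inl_inl_eq_zero_of_lt` (the table vanishes unless `|y − u|₁ ≤ 2`),
  **`tsum_dz_mul_wilsonA`** (`Σ'_y Σ_α (dz ψ) α y·W y z α β =` the same right-hand side), `tsum_wilsonA_mul_dz` (second slot) and
  `tsum_dz_mul_wilsonA_idx` (index slot: `Σ'_y Σ_μ (dz ψ) μ y·W μ y x z a b = ½(ψ z − ψ x)·(d*d δ_{(b,z)})_a(x)`).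
* (part 1b `GAN24.ContactOneGaugeCellMaxwell`: the Maxwell contraction `Σ'_z Σ_β T β z·(d*d δ_{(κ′,u)})_β z = (d*d T)_{κ′} u` and its window forms.)
⇒ per index bond `(κ′,u)` and table leg `(β,z)` the one-gauge contact summand is `½ψ_tip·(d*d-entry) − ½ψ_mid·(d*d-entry)`: contracted with the index
leg `T₁` and the other table leg `T₃` it is `½⟨ψ_tip·T₁, d*dT₃⟩ − ½⟨ψ_mid·T₃, d*dT₁⟩` — part 2 (`GAN24.ContactOneGaugeCell`) does that contraction under
decay envelopes and bounds it («envelopes in, `L^{d+1}·e^{−κ′·spread}` out»), with part 1b's Maxwell contraction.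
Provenance: seat b2b-balaban-gan24-formalise-leaf-02 gen 46 (prover-…-leaf-02-g46-0), 2026-08-21; over the files named above BY NAME.
-/

namespace Summit.QuantumFields.BalabanUV.Beta.GAN24.ContactOneGaugeCellAlgebra

open Finset
open scoped BigOperators
open Literature.MathematicalPhysics.QuantumFieldTheory.Balaban1983to89
open Literature.MathematicalPhysics.QuantumFieldTheory.Balaban1983to89.Beta
open B12Sec2to5 (l1 l1_nonneg)
open StepJetData (wilsonA wilsonA_antisymm wEntry wEntry_eq_zero_or l1_unitVec)
open AffineAveraging (Form1 dz curv curvAdj)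
open B6BondElimination (unitVec unitVec_apply)
open KKTFluctuationKernel (delta1 delta1_apply)
open Summit.QuantumFields.BalabanUV.Beta.AxialDressingRooted (cube mem_cube)
open Summit.QuantumFields.BalabanUV.Beta.GAN24.WilsonGaugeLegContact (gaugeLeg_wilsonA_inl_inl gaugeLeg_wilsonA_inl_inl_right
  gaugeLeg_wilsonA_eq_zero)
open KernelWard (divV)
open Summit.QuantumFields.BalabanUV.Beta.WardLocusStencils (divV_apply)
open Summit.QuantumFields.BalabanUV.Beta.WilsonDivergenceContact (divV_wilsonA_inl_inl divV_wilsonA_eq_zero)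

noncomputable section

variable {d : ℕ}

/-! ## §1 The gauge-site sum is finitely supported: the by-parts law for every gauge function -/

section GaugeSite

/-- [folklore] Kronecker sums over a finite set containing the point: `Σ_{y ∈ S} ψ y · [a = y] = ψ a` for `a ∈ S`. -/
theorem sum_mul_ite_eq_of_mem (ψ : (Fin (d + 1) → ℤ) → ℝ) {S : Finset (Fin (d + 1) → ℤ)} {a : Fin (d + 1) → ℤ} (ha : a ∈ S) :
    (∑ y ∈ S, ψ y * (if a = y then (1 : ℝ) else 0)) = ψ a := by
  have h : ∀ y ∈ S, ψ y * (if a = y then (1 : ℝ) else 0) = if a = y then ψ y else 0 := by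
    intro y _; split_ifs <;> simp
  rw [Finset.sum_congr rfl h, Finset.sum_ite_eq, if_pos ha]

/-- [folklore] **THE GAUGE-LEG LAW SUMMED AGAINST ANY GAUGE FUNCTION OVER ANY FINITE SET CONTAINING THE THREE CONTACT SITES**
(`u + e_{κ′}`, `z`, `z + e_β`): `Σ_{y ∈ S} ψ y · Σ_α (W(y − e_α) − W(y)) = ½·(ψ(u + e_{κ′}) − ½(ψ z + ψ(z + e_β)))·(d*d δ_{(κ′,u)})_β(z)` —
no hypothesis on `ψ` off `S` (gen 45's `gaugeLeg_wilsonA_pair` asked `ψ` to vanish off `S`). -/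
theorem gaugeLeg_wilsonA_sum_of_mem (κ' : Fin (d + 1)) (u z : Fin (d + 1) → ℤ) (β : Fin (d + 1)) (ψ : (Fin (d + 1) → ℤ) → ℝ)
    (S : Finset (Fin (d + 1) → ℤ)) (hu : u + unitVec κ' ∈ S) (hz : z ∈ S) (hzb : z + unitVec β ∈ S) :
    (∑ y ∈ S, ψ y * ∑ α, (wilsonA d κ' u (y - unitVec α) z (Sum.inl α) (Sum.inl β) - wilsonA d κ' u y z (Sum.inl α) (Sum.inl β))) =
      (1 / 2 : ℝ) * (ψ (u + unitVec κ') - (ψ z + ψ (z + unitVec β)) / 2) * curvAdj (curv (delta1 κ' u)) β z := by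
  simp only [gaugeLeg_wilsonA_inl_inl]
  have e : ∀ y ∈ S, ψ y * ((1 / 2 : ℝ) * ((if u + unitVec κ' = y then 1 else 0) -
      ((if z = y then 1 else 0) + (if z + unitVec β = y then 1 else 0)) / 2) * curvAdj (curv (delta1 κ' u)) β z) =
      (1 / 2 : ℝ) * curvAdj (curv (delta1 κ' u)) β z * (ψ y * (if u + unitVec κ' = y then 1 else 0)) -
        (1 / 4 : ℝ) * curvAdj (curv (delta1 κ' u)) β z * (ψ y * (if z = y then 1 else 0)) -
        (1 / 4 : ℝ) * curvAdj (curv (delta1 κ' u)) β z * (ψ y * (if z + unitVec β = y then 1 else 0)) := by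
    intro y _; ring
  rw [Finset.sum_congr rfl e, Finset.sum_sub_distrib, Finset.sum_sub_distrib, ← Finset.mul_sum, ← Finset.mul_sum, ← Finset.mul_sum,
    sum_mul_ite_eq_of_mem ψ hu, sum_mul_ite_eq_of_mem ψ hz, sum_mul_ite_eq_of_mem ψ hzb]
  ring

/-- [folklore] Off the three contact sites the `ψ`-weighted gauge-leg summand vanishes. -/
theorem mul_gaugeLeg_wilsonA_eq_zero (κ' : Fin (d + 1)) (u z : Fin (d + 1) → ℤ) (β : Fin (d + 1)) (ψ : (Fin (d + 1) → ℤ) → ℝ)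
    {y : Fin (d + 1) → ℤ} (hy : y ∉ ({u + unitVec κ', z, z + unitVec β} : Finset (Fin (d + 1) → ℤ))) :
    ψ y * ∑ α, (wilsonA d κ' u (y - unitVec α) z (Sum.inl α) (Sum.inl β) - wilsonA d κ' u y z (Sum.inl α) (Sum.inl β)) = 0 := by
  have hu : u + unitVec κ' ≠ y := fun h => hy (by rw [← h]; simp)
  have hz : z ≠ y := fun h => hy (by rw [← h]; simp)
  have hzb : z + unitVec β ≠ y := fun h => hy (by rw [← h]; simp)
  rw [gaugeLeg_wilsonA_eq_zero hu hz hzb, mul_zero]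

/-- [folklore] The `ψ`-weighted gauge-leg summand is summable over the gauge site (finite support). -/
theorem summable_gaugeLeg_wilsonA (κ' : Fin (d + 1)) (u z : Fin (d + 1) → ℤ) (β : Fin (d + 1)) (ψ : (Fin (d + 1) → ℤ) → ℝ) :
    Summable fun y => ψ y * ∑ α, (wilsonA d κ' u (y - unitVec α) z (Sum.inl α) (Sum.inl β) - wilsonA d κ' u y z (Sum.inl α) (Sum.inl β)) := by
  classical
  exact summable_of_ne_finset_zero fun y hy => mul_gaugeLeg_wilsonA_eq_zero κ' u z β ψ hy

/-- [folklore] **THE GAUGE-LEG LAW SUMMED AGAINST ANY GAUGE FUNCTION OVER THE WHOLE LATTICE** (first table slot):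
`Σ'_y ψ y · Σ_α (W (y − e_α) z α β − W y z α β) = ½·(ψ(u + e_{κ′}) − ½(ψ z + ψ(z + e_β)))·(d*d δ_{(κ′,u)})_β(z)` — TIP value of `ψ` on the
index bond minus MIDPOINT value on the other table leg, against the curl–curl contact; valid for EVERY `ψ` (the sum has three nonzero terms). -/
theorem gaugeLeg_wilsonA_tsum (κ' : Fin (d + 1)) (u z : Fin (d + 1) → ℤ) (β : Fin (d + 1)) (ψ : (Fin (d + 1) → ℤ) → ℝ) :
    ∑' y, ψ y * ∑ α, (wilsonA d κ' u (y - unitVec α) z (Sum.inl α) (Sum.inl β) - wilsonA d κ' u y z (Sum.inl α) (Sum.inl β)) =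
      (1 / 2 : ℝ) * (ψ (u + unitVec κ') - (ψ z + ψ (z + unitVec β)) / 2) * curvAdj (curv (delta1 κ' u)) β z := by
  classical
  rw [tsum_eq_sum (s := ({u + unitVec κ', z, z + unitVec β} : Finset (Fin (d + 1) → ℤ)))
    (fun y hy => mul_gaugeLeg_wilsonA_eq_zero κ' u z β ψ hy)]
  exact gaugeLeg_wilsonA_sum_of_mem κ' u z β ψ _ (by simp) (by simp) (by simp)

/-- [folklore] **SECOND TABLE SLOT** (by `wilsonA_antisymm`): `Σ'_y ψ y · Σ_β (W x (y − e_β) α β − W x y α β)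
  = −½·(ψ(u + e_{κ′}) − ½(ψ x + ψ(x + e_α)))·(d*d δ_{(κ′,u)})_α(x)`, for EVERY `ψ`. -/
theorem gaugeLeg_wilsonA_tsum_right (κ' : Fin (d + 1)) (u x : Fin (d + 1) → ℤ) (α : Fin (d + 1)) (ψ : (Fin (d + 1) → ℤ) → ℝ) :
    ∑' y, ψ y * ∑ β, (wilsonA d κ' u x (y - unitVec β) (Sum.inl α) (Sum.inl β) - wilsonA d κ' u x y (Sum.inl α) (Sum.inl β)) =
      -((1 / 2 : ℝ) * (ψ (u + unitVec κ') - (ψ x + ψ (x + unitVec α)) / 2) * curvAdj (curv (delta1 κ' u)) α x) := by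
  have h : ∀ y, ψ y * ∑ β, (wilsonA d κ' u x (y - unitVec β) (Sum.inl α) (Sum.inl β) - wilsonA d κ' u x y (Sum.inl α) (Sum.inl β)) =
      -(ψ y * ∑ β, (wilsonA d κ' u (y - unitVec β) x (Sum.inl β) (Sum.inl α) - wilsonA d κ' u y x (Sum.inl β) (Sum.inl α))) := by
    intro y
    rw [← mul_neg, ← Finset.sum_neg_distrib]
    congr 1
    refine Finset.sum_congr rfl fun β _ => ?_
    rw [wilsonA_antisymm κ' u (y - unitVec β) x (Sum.inl β) (Sum.inl α), wilsonA_antisymm κ' u y x (Sum.inl β) (Sum.inl α)]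
    ring
  rw [tsum_congr h, tsum_neg, gaugeLeg_wilsonA_tsum]

/-- [folklore] Second slot: summability over the gauge site. -/
theorem summable_gaugeLeg_wilsonA_right (κ' : Fin (d + 1)) (u x : Fin (d + 1) → ℤ) (α : Fin (d + 1)) (ψ : (Fin (d + 1) → ℤ) → ℝ) :
    Summable fun y => ψ y * ∑ β, (wilsonA d κ' u x (y - unitVec β) (Sum.inl α) (Sum.inl β) - wilsonA d κ' u x y (Sum.inl α) (Sum.inl β)) := by
  have h : ∀ y, ψ y * ∑ β, (wilsonA d κ' u x (y - unitVec β) (Sum.inl α) (Sum.inl β) - wilsonA d κ' u x y (Sum.inl α) (Sum.inl β)) =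
      -(ψ y * ∑ β, (wilsonA d κ' u (y - unitVec β) x (Sum.inl β) (Sum.inl α) - wilsonA d κ' u y x (Sum.inl β) (Sum.inl α))) := by
    intro y
    rw [← mul_neg, ← Finset.sum_neg_distrib]
    congr 1
    refine Finset.sum_congr rfl fun β _ => ?_
    rw [wilsonA_antisymm κ' u (y - unitVec β) x (Sum.inl β) (Sum.inl α), wilsonA_antisymm κ' u y x (Sum.inl β) (Sum.inl α)]
    ring
  exact ((summable_gaugeLeg_wilsonA κ' u x α ψ).neg).congr fun y => (h y).symm

/-- [folklore] **THE INDEX SLOT** (D1-leaf-05's divergence law `WilsonDivergenceContact.divV_wilsonA_inl_inl`, SITE weights), summed against ANY gauge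
function over the whole lattice: `Σ'_y ψ y · Σ_μ (W μ (y − e_μ) x z a b − W μ y x z a b) = ½·(ψ z − ψ x)·(d*d δ_{(b,z)})_a(x)` — the gauge variation
`B ↦ B + dψ` of the INDEX bond of the cubic Wilson table is the Maxwell contact between its two table legs weighted by `ψ` at their SITES. -/
theorem gaugeIdx_wilsonA_tsum (x z : Fin (d + 1) → ℤ) (a b : Fin (d + 1)) (ψ : (Fin (d + 1) → ℤ) → ℝ) :
    ∑' y, ψ y * ∑ μ, (wilsonA d μ (y - unitVec μ) x z (Sum.inl a) (Sum.inl b) - wilsonA d μ y x z (Sum.inl a) (Sum.inl b)) =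
      (1 / 2 : ℝ) * (ψ z - ψ x) * curvAdj (curv (delta1 b z)) a x := by
  classical
  have hdiv : ∀ y, (∑ μ, (wilsonA d μ (y - unitVec μ) x z (Sum.inl a) (Sum.inl b) - wilsonA d μ y x z (Sum.inl a) (Sum.inl b))) =
      divV (wilsonA d) y x z (Sum.inl a) (Sum.inl b) := fun y => (divV_apply (wilsonA d) y x z (Sum.inl a) (Sum.inl b)).symm
  simp_rw [hdiv]
  rw [tsum_eq_sum (s := ({x, z} : Finset (Fin (d + 1) → ℤ))) (fun y hy => by
    have hx : x ≠ y := fun h => hy (by rw [← h]; simp)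
    have hz : z ≠ y := fun h => hy (by rw [← h]; simp)
    rw [divV_wilsonA_eq_zero hx hz, mul_zero])]
  have e : ∀ y ∈ ({x, z} : Finset (Fin (d + 1) → ℤ)), ψ y * divV (wilsonA d) y x z (Sum.inl a) (Sum.inl b) =
      (1 / 2 : ℝ) * curvAdj (curv (delta1 b z)) a x * (ψ y * (if z = y then 1 else 0)) -
        (1 / 2 : ℝ) * curvAdj (curv (delta1 b z)) a x * (ψ y * (if x = y then 1 else 0)) := by
    intro y _
    rw [divV_wilsonA_inl_inl]
    have h1 : (if z = y then (1 : ℝ) else 0) = (if y = z then 1 else 0) := by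
      by_cases h : z = y
      · rw [if_pos h, if_pos h.symm]
      · rw [if_neg h, if_neg (fun h' => h h'.symm)]
    have h2 : (if x = y then (1 : ℝ) else 0) = (if y = x then 1 else 0) := by
      by_cases h : x = y
      · rw [if_pos h, if_pos h.symm]
      · rw [if_neg h, if_neg (fun h' => h h'.symm)]
    rw [h1, h2]
    ring
  rw [Finset.sum_congr rfl e, Finset.sum_sub_distrib, ← Finset.mul_sum, ← Finset.mul_sum,
    sum_mul_ite_eq_of_mem ψ (by simp : z ∈ ({x, z} : Finset (Fin (d + 1) → ℤ))),
    sum_mul_ite_eq_of_mem ψ (by simp : x ∈ ({x, z} : Finset (Fin (d + 1) → ℤ)))]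
  ring

/-- [folklore] Index slot: the `ψ`-weighted divergence summand is summable over the gauge site (finite support `{x, z}`). -/
theorem summable_gaugeIdx_wilsonA (x z : Fin (d + 1) → ℤ) (a b : Fin (d + 1)) (ψ : (Fin (d + 1) → ℤ) → ℝ) :
    Summable fun y => ψ y * ∑ μ, (wilsonA d μ (y - unitVec μ) x z (Sum.inl a) (Sum.inl b) - wilsonA d μ y x z (Sum.inl a) (Sum.inl b)) := by
  classical
  refine summable_of_ne_finset_zero (s := ({x, z} : Finset (Fin (d + 1) → ℤ))) fun y hy => ?_
  have hx : x ≠ y := fun h => hy (by rw [← h]; simp)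
  have hz : z ≠ y := fun h => hy (by rw [← h]; simp)
  rw [← divV_apply, divV_wilsonA_eq_zero hx hz, mul_zero]

end GaugeSite

/-! ## §2 The `dψ`-form: what a pure-gauge leg `dz ψ` inserts into the table -/

section DzForm

/-- [folklore] The two unit-vector spellings of the tree agree: `AffineAveraging.unitVec κ = B6BondElimination.unitVec κ`. -/
theorem affine_unitVec_eq (κ : Fin (d + 1)) : AffineAveraging.unitVec κ = unitVec κ := by
  funext i
  rw [AffineAveraging.unitVec_apply, unitVec_apply]

/-- [folklore] `dz` in the `B6BondElimination.unitVec` spelling: `(dz ψ)_α(y) = ψ(y + e_α) − ψ y`. -/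
theorem dz_apply' (ψ : (Fin (d + 1) → ℤ) → ℝ) (α : Fin (d + 1)) (y : Fin (d + 1) → ℤ) : dz ψ α y = ψ (y + unitVec α) - ψ y := by
  rw [← affine_unitVec_eq]; rfl

/-- [folklore] Coordinates are bounded by the `ℓ¹` norm: `|v i| ≤ |v|₁`. -/
theorem abs_apply_le_l1 (v : Fin (d + 1) → ℤ) (i : Fin (d + 1)) : ((|v i| : ℤ) : ℝ) ≤ l1 v := by
  unfold l1
  rw [Int.cast_abs]
  exact Finset.single_le_sum (f := fun μ => |((v μ : ℤ) : ℝ)|) (fun μ _ => abs_nonneg _) (Finset.mem_univ i)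

/-- [folklore] An `ℓ¹` ball of radius `2` sits inside the window `cube 2`. -/
theorem mem_cube_two_of_l1_le {v : Fin (d + 1) → ℤ} (hv : l1 v ≤ 2) : v ∈ cube (d + 1) 2 := by
  refine mem_cube.2 fun i => ?_
  have h := (abs_apply_le_l1 v i).trans hv
  exact_mod_cast h

/-- [folklore] **THE CUBIC WILSON TABLE IS LOCAL IN ITS FIRST TABLE LEG**: the field–field entry `W κ′ u y z α β` vanishes unless `|y − u|₁ ≤ 2`
(an3's plaquette support, `StepJetData.wEntry_eq_zero_or`). -/
theorem wilsonA_inl_inl_eq_zero_of_lt (κ' : Fin (d + 1)) (u y z : Fin (d + 1) → ℤ) (α β : Fin (d + 1)) (hy : 2 < l1 (y - u)) :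
    wilsonA d κ' u y z (Sum.inl α) (Sum.inl β) = 0 := by
  have h1 : wEntry d κ' u y z α β = 0 := by
    rcases wEntry_eq_zero_or κ' u y z α β with h | ⟨h, _⟩
    · exact h
    · exact absurd h (not_le.2 hy)
  have h2 : wEntry d κ' u z y β α = 0 := by
    rcases wEntry_eq_zero_or κ' u z y β α with h | ⟨_, h⟩
    · exact h
    · exact absurd h (not_le.2 hy)
  show (1 / 2 : ℝ) * (wEntry d κ' u y z α β - wEntry d κ' u z y β α) = 0
  rw [h1, h2, sub_zero, mul_zero]

/-- [folklore] The same locality in the SECOND table leg. -/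
theorem wilsonA_inl_inl_eq_zero_of_lt_right (κ' : Fin (d + 1)) (u x y : Fin (d + 1) → ℤ) (α β : Fin (d + 1)) (hy : 2 < l1 (y - u)) :
    wilsonA d κ' u x y (Sum.inl α) (Sum.inl β) = 0 := by
  rw [wilsonA_antisymm κ' u y x (Sum.inl β) (Sum.inl α), wilsonA_inl_inl_eq_zero_of_lt κ' u y x β α hy, neg_zero]

/-- [folklore] A function of the first table leg weighted by the table is finitely supported (window `u + cube 2`), hence summable. -/
theorem summable_mul_wilsonA (κ' : Fin (d + 1)) (u z : Fin (d + 1) → ℤ) (α β : Fin (d + 1)) (g : (Fin (d + 1) → ℤ) → ℝ) :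
    Summable fun y => g y * wilsonA d κ' u y z (Sum.inl α) (Sum.inl β) := by
  classical
  refine summable_of_ne_finset_zero (s := (cube (d + 1) 2).image fun v => u + v) fun y hy => ?_
  have hy' : 2 < l1 (y - u) := by
    by_contra h
    refine hy (Finset.mem_image.2 ⟨y - u, mem_cube_two_of_l1_le (not_lt.1 h), by abel⟩)
  rw [wilsonA_inl_inl_eq_zero_of_lt κ' u y z α β hy', mul_zero]

/-- [folklore] Second slot: the same summability. -/
theorem summable_mul_wilsonA_right (κ' : Fin (d + 1)) (u x : Fin (d + 1) → ℤ) (α β : Fin (d + 1)) (g : (Fin (d + 1) → ℤ) → ℝ) :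
    Summable fun y => g y * wilsonA d κ' u x y (Sum.inl α) (Sum.inl β) := by
  refine ((summable_mul_wilsonA κ' u x β α g).neg).congr fun y => ?_
  rw [wilsonA_antisymm κ' u y x (Sum.inl β) (Sum.inl α), mul_neg]

/-- [folklore] **THE `dψ`-FORM OF THE FIRST-SLOT LAW** — a pure-gauge first table leg `(dz ψ)_α(y) = ψ(y + e_α) − ψ y` inserted into the cubic
Wilson table gives the Maxwell contact: `Σ'_y Σ_α (dz ψ) α y · W κ′ u y z α β = ½·(ψ(u + e_{κ′}) − ½(ψ z + ψ(z + e_β)))·(d*d δ_{(κ′,u)})_β(z)`,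
for EVERY `ψ` (summation by parts on the finitely supported table, then §1). -/
theorem tsum_dz_mul_wilsonA (κ' : Fin (d + 1)) (u z : Fin (d + 1) → ℤ) (β : Fin (d + 1)) (ψ : (Fin (d + 1) → ℤ) → ℝ) :
    ∑' y, ∑ α, dz ψ α y * wilsonA d κ' u y z (Sum.inl α) (Sum.inl β) =
      (1 / 2 : ℝ) * (ψ (u + unitVec κ') - (ψ z + ψ (z + unitVec β)) / 2) * curvAdj (curv (delta1 κ' u)) β z := by
  rw [← gaugeLeg_wilsonA_tsum κ' u z β ψ]
  -- summability of every piece (finite support in the first table leg)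
  have hs1 : ∀ α, Summable fun y => ψ (y + unitVec α) * wilsonA d κ' u y z (Sum.inl α) (Sum.inl β) :=
    fun α => summable_mul_wilsonA κ' u z α β (fun y => ψ (y + unitVec α))
  have hs2 : ∀ α, Summable fun y => ψ y * wilsonA d κ' u y z (Sum.inl α) (Sum.inl β) :=
    fun α => summable_mul_wilsonA κ' u z α β ψ
  have hs3 : ∀ α, Summable fun y => ψ y * wilsonA d κ' u (y - unitVec α) z (Sum.inl α) (Sum.inl β) := by
    intro α
    have h := (Equiv.subRight (unitVec α)).summable_iff.2 (hs1 α)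
    refine h.congr fun y => ?_
    simp only [Function.comp_apply, Equiv.subRight_apply, sub_add_cancel]
  -- by parts: shift the first piece
  have hshift : ∀ α, ∑' y, ψ (y + unitVec α) * wilsonA d κ' u y z (Sum.inl α) (Sum.inl β) =
      ∑' y, ψ y * wilsonA d κ' u (y - unitVec α) z (Sum.inl α) (Sum.inl β) := by
    intro α
    rw [← (Equiv.subRight (unitVec α)).tsum_eq (fun y => ψ (y + unitVec α) * wilsonA d κ' u y z (Sum.inl α) (Sum.inl β))]
    refine tsum_congr fun y => ?_
    simp only [Equiv.subRight_apply, sub_add_cancel]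
  have hL : ∀ y, ∑ α, dz ψ α y * wilsonA d κ' u y z (Sum.inl α) (Sum.inl β) =
      ∑ α, (ψ (y + unitVec α) * wilsonA d κ' u y z (Sum.inl α) (Sum.inl β) - ψ y * wilsonA d κ' u y z (Sum.inl α) (Sum.inl β)) := by
    intro y
    refine Finset.sum_congr rfl fun α _ => ?_
    rw [dz_apply']; ring
  have hR : ∀ y, ψ y * ∑ α, (wilsonA d κ' u (y - unitVec α) z (Sum.inl α) (Sum.inl β) - wilsonA d κ' u y z (Sum.inl α) (Sum.inl β)) =
      ∑ α, (ψ y * wilsonA d κ' u (y - unitVec α) z (Sum.inl α) (Sum.inl β) - ψ y * wilsonA d κ' u y z (Sum.inl α) (Sum.inl β)) := by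
    intro y
    rw [Finset.mul_sum]
    refine Finset.sum_congr rfl fun α _ => ?_
    ring
  rw [tsum_congr hL, tsum_congr hR, Summable.tsum_finsetSum (fun α _ => (hs1 α).sub (hs2 α)),
    Summable.tsum_finsetSum (fun α _ => (hs3 α).sub (hs2 α))]
  refine Finset.sum_congr rfl fun α _ => ?_
  rw [(hs1 α).tsum_sub (hs2 α), (hs3 α).tsum_sub (hs2 α), hshift α]

/-- [folklore] **THE `dψ`-FORM OF THE SECOND-SLOT LAW**: `Σ'_y Σ_β W κ′ u x y α β · (dz ψ) β y
  = −½·(ψ(u + e_{κ′}) − ½(ψ x + ψ(x + e_α)))·(d*d δ_{(κ′,u)})_α(x)`. -/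
theorem tsum_wilsonA_mul_dz (κ' : Fin (d + 1)) (u x : Fin (d + 1) → ℤ) (α : Fin (d + 1)) (ψ : (Fin (d + 1) → ℤ) → ℝ) :
    ∑' y, ∑ β, wilsonA d κ' u x y (Sum.inl α) (Sum.inl β) * dz ψ β y =
      -((1 / 2 : ℝ) * (ψ (u + unitVec κ') - (ψ x + ψ (x + unitVec α)) / 2) * curvAdj (curv (delta1 κ' u)) α x) := by
  rw [← tsum_dz_mul_wilsonA κ' u x α ψ, ← tsum_neg]
  refine tsum_congr fun y => ?_
  rw [← Finset.sum_neg_distrib]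
  refine Finset.sum_congr rfl fun β _ => ?_
  rw [wilsonA_antisymm κ' u y x (Sum.inl β) (Sum.inl α)]
  ring

/-- [folklore] The cubic Wilson table is local in its INDEX bond too: `W μ y x z a b = 0` unless `|x − y|₁ ≤ 2` (read off the first-leg locality). -/
theorem wilsonA_inl_inl_eq_zero_of_lt_idx (μ : Fin (d + 1)) (y x z : Fin (d + 1) → ℤ) (a b : Fin (d + 1)) (hy : 2 < l1 (x - y)) :
    wilsonA d μ y x z (Sum.inl a) (Sum.inl b) = 0 :=
  wilsonA_inl_inl_eq_zero_of_lt μ y x z a b hy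

/-- [folklore] A function of the INDEX bond's site weighted by the table is finitely supported (window `x − cube 2`), hence summable. -/
theorem summable_mul_wilsonA_idx (μ : Fin (d + 1)) (x z : Fin (d + 1) → ℤ) (a b : Fin (d + 1)) (g : (Fin (d + 1) → ℤ) → ℝ) :
    Summable fun y => g y * wilsonA d μ y x z (Sum.inl a) (Sum.inl b) := by
  classical
  refine summable_of_ne_finset_zero (s := (cube (d + 1) 2).image fun v => x - v) fun y hy => ?_
  have hy' : 2 < l1 (x - y) := by
    by_contra h
    refine hy (Finset.mem_image.2 ⟨x - y, mem_cube_two_of_l1_le (not_lt.1 h), by abel⟩)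
  rw [wilsonA_inl_inl_eq_zero_of_lt_idx μ y x z a b hy', mul_zero]

/-- [folklore] **THE `dψ`-FORM OF THE INDEX-SLOT LAW** — the pure-gauge variation `B ↦ B + dψ` of the index bond inserted into the cubic Wilson table:
`Σ'_y Σ_μ (dz ψ) μ y · W μ y x z a b = ½·(ψ z − ψ x)·(d*d δ_{(b,z)})_a(x)`, for EVERY `ψ`. -/
theorem tsum_dz_mul_wilsonA_idx (x z : Fin (d + 1) → ℤ) (a b : Fin (d + 1)) (ψ : (Fin (d + 1) → ℤ) → ℝ) :
    ∑' y, ∑ μ, dz ψ μ y * wilsonA d μ y x z (Sum.inl a) (Sum.inl b) = (1 / 2 : ℝ) * (ψ z - ψ x) * curvAdj (curv (delta1 b z)) a x := by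
  rw [← gaugeIdx_wilsonA_tsum x z a b ψ]
  have hs1 : ∀ μ, Summable fun y => ψ (y + unitVec μ) * wilsonA d μ y x z (Sum.inl a) (Sum.inl b) :=
    fun μ => summable_mul_wilsonA_idx μ x z a b (fun y => ψ (y + unitVec μ))
  have hs2 : ∀ μ, Summable fun y => ψ y * wilsonA d μ y x z (Sum.inl a) (Sum.inl b) :=
    fun μ => summable_mul_wilsonA_idx μ x z a b ψ
  have hs3 : ∀ μ, Summable fun y => ψ y * wilsonA d μ (y - unitVec μ) x z (Sum.inl a) (Sum.inl b) := by
    intro μ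
    have h := (Equiv.subRight (unitVec μ)).summable_iff.2 (hs1 μ)
    refine h.congr fun y => ?_
    simp only [Function.comp_apply, Equiv.subRight_apply, sub_add_cancel]
  have hshift : ∀ μ, ∑' y, ψ (y + unitVec μ) * wilsonA d μ y x z (Sum.inl a) (Sum.inl b) =
      ∑' y, ψ y * wilsonA d μ (y - unitVec μ) x z (Sum.inl a) (Sum.inl b) := by
    intro μ
    rw [← (Equiv.subRight (unitVec μ)).tsum_eq (fun y => ψ (y + unitVec μ) * wilsonA d μ y x z (Sum.inl a) (Sum.inl b))]
    refine tsum_congr fun y => ?_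
    simp only [Equiv.subRight_apply, sub_add_cancel]
  have hL : ∀ y, ∑ μ, dz ψ μ y * wilsonA d μ y x z (Sum.inl a) (Sum.inl b) =
      ∑ μ, (ψ (y + unitVec μ) * wilsonA d μ y x z (Sum.inl a) (Sum.inl b) - ψ y * wilsonA d μ y x z (Sum.inl a) (Sum.inl b)) := by
    intro y
    refine Finset.sum_congr rfl fun μ _ => ?_
    rw [dz_apply']; ring
  have hR : ∀ y, ψ y * ∑ μ, (wilsonA d μ (y - unitVec μ) x z (Sum.inl a) (Sum.inl b) - wilsonA d μ y x z (Sum.inl a) (Sum.inl b)) =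
      ∑ μ, (ψ y * wilsonA d μ (y - unitVec μ) x z (Sum.inl a) (Sum.inl b) - ψ y * wilsonA d μ y x z (Sum.inl a) (Sum.inl b)) := by
    intro y
    rw [Finset.mul_sum]
    refine Finset.sum_congr rfl fun μ _ => ?_
    ring
  rw [tsum_congr hL, tsum_congr hR, Summable.tsum_finsetSum (fun μ _ => (hs1 μ).sub (hs2 μ)),
    Summable.tsum_finsetSum (fun μ _ => (hs3 μ).sub (hs2 μ))]
  refine Finset.sum_congr rfl fun μ _ => ?_
  rw [(hs1 μ).tsum_sub (hs2 μ), (hs3 μ).tsum_sub (hs2 μ), hshift μ]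

end DzForm


end

end Summit.QuantumFields.BalabanUV.Beta.GAN24.ContactOneGaugeCellAlgebra
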